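import Literature.MathematicalPhysics.QuantumFieldTheory.Balaban1983to89.Node00.TorusCoverGaugeTokens152153BoxFiner

/-!
# NODE 00 — THE FAMILIES-LEVEL (152)+(153) DOOR OF [Balaban1985Variational] AT EVERY DATUM MEETING `Ω_n`, UNIFORM IN THE RECORD'S BASIC CUBE SIZE:
# generation 5's `gauge152_REfiner153_box_of_within_of_prop6P` with the CUBE LETTER that keys the constants `b9OfP` ∕ `a0OfP` DECOUPLED from the letter `M` of the
# record's sequence `s : SeqOfRecord F ν M g K k` — the record's `M` appears only through `s`

Cell `pub-ymgap`, width seat `pub-ymgap-dag-n07-w3` generation 6, CLAIM-3 ∕ INTENT-3 + LOCATED-M-COUPLING (cell INBOX 2026-08-28).  NEW leaf, PROOF kind (no `def`, no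
`instance`, no `notation`).  CONSUMED BY NAME, nothing modified: generation 5's `Node00.TorusCoverLandau153REFiner`
(`exists_localGauge152_REfiner153_coverBox_propCubeP_of_prop6P` — generation 3's generic-`P` door with the sixth clause at every kernel-finer family; it carries NO basic-cube
letter at all), `pub-ymgap-dag-n07-w4`'s `Node00.TorusCoverCollarOfMeetsPrint` (`Sect2.hcollar_cubeIdxP'_of_within_mem`), dag-n07-e's FILE P3 `Node00.TorusCoverGaugeTokensRPrint`
(`b9OfP`, `a0OfP`, `a0OfP_pos`), FILE P1 `Node00.TorusCoverCubeMemberPrint` (`propCubeP`, `cornerP`, `sideP`, `sideP_le`, `le_sideP`, `boxWidth_propCubeP`; the projections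
`propCubeP_a ∕ _M ∕ _ρ ∕ _k` are `rfl`) and module 39 `cubeDomains`; k0-s2-w2's `prop6Printed_zdCubP_anti`; def-R's `suppDomOfRecord_eq`; lit-balaban p21's `RE` ∕ `dsE` ∕ `QpE`,
`Domains`.  Filed `--kind proof --supports stmt-QuantumFields-27364` (K1⁹ `StabilityBRunRowsAtRecordR13SepCoPHV`, the K1-face item of route `BalabanUVNodes` rev 29; a
count-neutral helper).  [15] = [Balaban1985Variational]; [6] = [Balaban1985RegularSpaces]; [B6] = [Balaban1984PropagatorsII]; [III] = [Balaban1988Convergent].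

WHY (LOCATED-M-COUPLING, cell INBOX 2026-08-28).  The S6 head's per-datum token `DatumGaugeSplitTopStepCoreR F N Sup Mc ρ c B₃ C θ Q κ a₀ a₁`
(`Summits/…/BalabanUVNodesN07LocalLettersCoreFloor.lean` §4) — like stub 1's `Node00.Prop8RegSepTopStep` — fixes the grid-cube letter `Mc`, the size `κ` and the ceiling `a₀`
OUTSIDE and quantifies the record's basic cube size INSIDE: `∀ (ν) (M : ℕ) (g) (K k) (s : SeqOfRecord F ν M g K k), …`.  Every earlier S3 door of this lineage (and dag-n07-e's
34c ∕ 36c tokens `Gauge152OfClassTopStepR10 F N Sup M …`, whose cubes ARE the partition's `M`-cubes) keys BOTH the datum's cube letter (`hM₀ : M₀ = M ∨ M₀ = L·M`) AND the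
constants (`ε_m ≤ a0OfP F N M ρ B₁ c₁`, letters at `b9OfP F M ρ B₁ · ε_n`) on that same record letter `M`; since `a0OfP F N M … ~ c₁ ∕ (56 L⁵ (LM + 44 + 2ρ))` tends to `0` and
`b9OfP F M …` to `∞` as `M → ∞`, no `a₀`, `κ` chosen outside `∀ M` can feed ∕ dominate them, and `Mc = M ∨ Mc = L·M` is unprovable for a fixed `Mc` — the door is uncallable
from inside the token except at `M ∈ {Mc, Mc ∕ L}`.  In print ([15] (144): *«unions of big blocks»*; [6] p. 98) `M` is ONE FIXED constant of the construction, so the coupling is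
harmless there; in the tree's binder block it is an interface coupling (the `M`-twin of dag-n07-e's LOCATED-STUB1-FLOOR, which concerned `ν.M₁`).  Nothing landed is false.

THE REPAIR (this file).  In generation 5's derivation the record's `M` enters only through `s` (the collar clause from the `Within`-witness, the (1.7)∕(1.9)-Top class
hypotheses `h17` ∕ `h19` over `suppDomOfRecord`); the cube letter of `hM₀` and of the constants is a SEPARATE letter `Mb`.  §1 ★★★ `gauge152_REfiner153_box_of_within_of_prop6P_uniform`:
generation 5's binder block with `(hMb : 1 ≤ Mb)`, `ε_m ≤ a0OfP F N Mb ρ B₁ c₁`, `hM₀ : M₀ = Mb ∨ M₀ = L·Mb`, letters at `b9OfP F Mb ρ B₁ · ε_n`, the record's `M` FREE (implicit,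
read off `s`); the window, the non-wrapping hypothesis and the cube tower of clause 6 are written in the head's letters `cornerP (F.P K) M₀ ρ a` ∕ `sideP (F.P K) M₀ ρ` ∕ `ρ`
(= `(propCubeP …).a ∕ .M ∕ .ρ` by `rfl`), so that the token's window `cover '' box L (cornerP Mc ρ a) (sideP Mc ρ) j` is matched literally.  ★ `…_uniform_of_one_le`: the same
at stub 2′'s bare `ρ₀ ≥ 1` (`ρ := ρ₀·L`).  THE HEAD'S CALL inside its token: `Mb := Mc`, `hM₀ := Or.inl rfl`, `κ := b9OfP F Mc ρ B₁`, `a₀ ≤ a0OfP F N Mc ρ B₁ c₁`,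
floor letter `c ≥ (11·4 + 4ρ + Mc + 3)·L` — all independent of the record's `M`.  Generation 5's door is the instance `Mb := M` (not restated).

HONEST FRAMING: count-neutral kernel-lane re-run of generation 5's bookkeeping with one letter decoupled (no new estimate, no new definition); [6] Proposition 6 on print's
class at the member is the HYPOTHESIS `hP6` (N05's node ∕ stub 2′'s body; never asserted here), applied once, to the CUBE datum; the non-wrapping of the datum's collared cube,
the floor, the radii and the `Within`-witness are DISPLAYED; the kernel inclusion of clause 6 is a hypothesis of that clause; nothing of Bałaban discharged; tokens ∕ stub 1 ∕
stub 2′ ∕ N07 ∕ N05 ∕ K0⁷ ∕ K1⁹ NOT closed; the cell's typed ∕ discharged counts are not moved by this file (the chair's tally of record is the only count); one finite 𝕋⁴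
programme at fixed ε — R4 closes the conditional finite-𝕋⁴ rung `BalabanLadder.UV` only; the YM mass gap (Clay) is NOT proved by any of this; nothing continuum ∕ ℝ⁴ ∕
infinite volume ∕ OS.  No `sorry`, no `def`, no `instance`, no `notation`.
-/

noncomputable section

namespace Literature.MathematicalPhysics.QuantumFieldTheory.Balaban1983to89.Node00

open scoped Matrix.Norms.L2Operator InnerProductSpace RealInnerProductSpace
open T4Continuum (T4Family)
open B15DeterminingSets B12RegularSpaces111
open B15Eq112TorusCover (cover)
open B14DomainGeom (Pt Within)
open B14.Eq213MaximalDomains (side cubeExt)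
open B7Prop1Explicit (e)
open B8Eq131Cubes (box cube tcube bLo bHi)
open B8LeafModelZd (ZdIdx)
open B6SectADomainsV1 (Domains)
open B6SectAOperatorsV1 (RE dsE QpE)
open BalabanImbrieJaffe1984to88.BIJ85AxialPropagator411 (BondSpace)

variable {F : T4Family} {N : ℕ} [NeZero N]

/-! ## §1  ★★★ Every datum MEETING `Ω_n`, constants keyed on the grid-cube letter, the record's `M` free -/

section Uniform

/-- ★★★ **THE FAMILIES-LEVEL DOOR AT EVERY DATUM MEETING `Ω_n`, UNIFORM IN THE RECORD'S BASIC CUBE SIZE** ([15] p. 300: *«Let us take a cube □ intersecting Ω_j but not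
Ω_{j+1}»*, (144) *«□ … a union of big blocks»*; p. 301 (150)–(153)).  Generation 5's `gauge152_REfiner153_box_of_within_of_prop6P` with the cube letter `Mb` of the
constants (`a0OfP F N Mb ρ B₁ c₁`, `b9OfP F Mb ρ B₁`) and of the datum side (`M₀ = Mb ∨ M₀ = L·Mb`) DECOUPLED from the record's `M` (which is read off
`s : SeqOfRecord F ν M g K k` and is otherwise unconstrained): [6] Prop. 6 on print's class — the HYPOTHESIS `hP6`; `1 ≤ Mb`; a separated index `s`; level radii
`0 < ε_m ≤ a0OfP F N Mb ρ B₁ c₁`, `ε_m ≤ 2ε_{m+1}`; `U` in the (1.7)∕(1.9)-Top class over `suppDomOfRecord`; `1 ≤ n ≤ k`, `n ≤ m + K`; a point `x` of the grid cube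
`cubeExt (side L M₀ n) a 0` within `Dw` of a lift `y` of a site of `Ω_n`; the floor `(11·4 + 4ρ + M₀ + Dw)·L ≤ ν.M₁`; the non-wrapping of the datum's collared cube
`cube L (cornerP M₀ ρ a) (sideP M₀ ρ) ρ n 0`.  CONCLUSION (window and cube tower in the letters `cornerP` ∕ `sideP`, = `(propCubeP …).a ∕ .M` by `rfl`): ONE gauge `u`, ONE
potential `A` — the gauge equation on the bonds of `regionOfSet (π '' box L (cornerP M₀ ρ a) (sideP M₀ ρ) n)`, `‖A‖, ‖∇A‖ < b9OfP F Mb ρ B₁ · ε_n` there, `‖∂*∂A‖, ‖ΔA‖ < …` on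
its deep bonds, and, for every `D′` with `ker Q′_{D′} ≤ ker Q′_{cubeDomains (cornerP M₀ ρ a) (sideP M₀ ρ) ρ n}` and every `φ`, `RE D′ η_n⁻¹ (dsE η_n⁻¹ (Re ∕ Im(φ∘A))) = 0`.
Proof: generation 5's derivation with `Mb` in place of the record's letter (print side `sideP M₀ ρ ≤ L·Mb + 44 + 2ρ`, «7dL²M′α₀ ≤ c₁» and the `2π`-window from
`ε_{n−1} ≤ a0OfP`, dag-n07-w4's collar clause by name, generation 3's generic-`P` finer door, letters at `2r < b9OfP·ε_n`).
[cite: Balaban1985Variational, (144) p.300, (150)–(153) p.301, p.302; Balaban1985RegularSpaces, Prop. 6 (1.135)–(1.138) p.99, p.98, (1.38) p.82; Balaban1984PropagatorsII, (2.7) p.224, (2.10)–(2.12) p.225; Balaban1988Convergent, p.255, (2.13) p.256] -/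
theorem gauge152_REfiner153_box_of_within_of_prop6P_uniform {B₁ c₁ : ℝ} (hB₁ : 0 ≤ B₁) (hc₁ : 0 < c₁) {ρ : ℕ}
    (hP6 : letI : CStarAlgebra (MatA N) := {}; B8.Prop6Printed 4 (F.L : ℝ) B₁ c₁ (fun i : ZdIdx 4 F.L => zdCubP (MatA N) F.L ρ i)) {Mb : ℕ} (hMb : 1 ≤ Mb)
    (ν : Stage7Numerics) {M : ℕ} (g : ℕ → ℝ) (K k : ℕ) (hρ : (F.P K).L ≤ ρ) (s : SeqOfRecord F ν M g K k) (hsep : Sect2.SeqSeparated ν.M₁ s)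
    (ε : ℕ → ℝ)
    (hε : ∀ m, m ≤ k → 0 < ε m ∧ ε m ≤ a0OfP F N Mb ρ B₁ c₁) (hcomp : ∀ m, m < k → ε m ≤ 2 * ε (m + 1))
    (U : GaugeField (F.P K) 0 (SU N))
    (h17 : ∀ m, m ≤ k → PlaqSmallOn (Sect2.omegaPlaqsTop s.Ω (suppDomOfRecord F ν K s.Ω) m) (ε m * (F.P K).eta m ^ 2) U)
    (h19 : ∀ m, m ≤ k → Sect2.CoDivSmallOn (Sect2.omegaBondsTop s.Ω (suppDomOfRecord F ν K s.Ω) m) (ε m * (F.P K).eta m ^ 3) U)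
    {n : ℕ} (hn1 : 1 ≤ n) (hnk : n ≤ k) (hnK : n ≤ (F.P K).m + (F.P K).K) {M₀ : ℕ} (hM₀ : M₀ = Mb ∨ M₀ = F.L * Mb)
    {Dw : ℕ} (hfloor : (11 * 4 + 4 * ρ + M₀ + Dw) * F.L ≤ ν.M₁) (a : Pt (F.P K).d) {x y : Pt (F.P K).d}
    (hx : x ∈ cubeExt (side (F.P K).L M₀ n) a 0) (hy : cover (F.P K) y ∈ s.Ω n) (hxy : Within (Dw : ℤ) x y)
    (hinj : Set.InjOn (cover (F.P K)) (cube (F.P K).L (cornerP (F.P K) M₀ ρ a) (sideP (F.P K) M₀ ρ) ρ n 0)) :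
    ∃ u : GaugeTransf (F.P K) 0 (SU N), ∃ A : PBond (F.P K) 0 → MatA N,
      (∀ b ∈ (Sect2.regionOfSet (F.P K) (cover (F.P K) '' box (F.P K).L (cornerP (F.P K) M₀ ρ a) (sideP (F.P K) M₀ ρ) n)).bonds,
          gaugeU (fun x => ιSU N (u x)) (fun b' => ιSU N (U b')) b = expI ((F.P K).eta n) (A b)) ∧
      (∀ b ∈ (Sect2.regionOfSet (F.P K) (cover (F.P K) '' box (F.P K).L (cornerP (F.P K) M₀ ρ a) (sideP (F.P K) M₀ ρ) n)).bonds,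
          ‖A b‖ < b9OfP F Mb ρ B₁ * ε n) ∧
      (∀ q ∈ (Sect2.regionOfSet (F.P K) (cover (F.P K) '' box (F.P K).L (cornerP (F.P K) M₀ ρ a) (sideP (F.P K) M₀ ρ) n)).dpairs,
          ‖grad ((F.P K).eta n) q.2.1 (fun y => A ⟨y, q.2.2⟩) q.1‖ < b9OfP F Mb ρ B₁ * ε n) ∧
      (∀ b ∈ Sect2.bondsDeep (cover (F.P K) '' box (F.P K).L (cornerP (F.P K) M₀ ρ a) (sideP (F.P K) M₀ ρ) n),
          ‖Sect2.codiffCurlA ((F.P K).eta n) A b.src b.dir‖ < b9OfP F Mb ρ B₁ * ε n) ∧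
      (∀ b ∈ Sect2.bondsDeep (cover (F.P K) '' box (F.P K).L (cornerP (F.P K) M₀ ρ a) (sideP (F.P K) M₀ ρ) n),
          ‖∑ ν' : Fin (F.P K).d, (((F.P K).eta n : ℝ) : ℂ)⁻¹ •
              (grad ((F.P K).eta n) ν' (fun y => A ⟨y, b.dir⟩) (b.src.unshift ν') - grad ((F.P K).eta n) ν' (fun y => A ⟨y, b.dir⟩) b.src)‖ <
            b9OfP F Mb ρ B₁ * ε n) ∧
      (∀ D' : Domains (F.P K),
        LinearMap.ker (QpE D') ≤ LinearMap.ker (QpE (cubeDomains (F.P K) (cornerP (F.P K) M₀ ρ a) (sideP (F.P K) M₀ ρ) ρ n hnK)) →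
        ∀ φ : MatA N →L[ℂ] ℂ,
          RE D' ((F.P K).eta n)⁻¹ (dsE ((F.P K).eta n)⁻¹ (WithLp.toLp 2 fun b => (φ (A b)).re : BondSpace (F.P K))) = 0 ∧
          RE D' ((F.P K).eta n)⁻¹ (dsE ((F.P K).eta n)⁻¹ (WithLp.toLp 2 fun b => (φ (A b)).im : BondSpace (F.P K))) = 0) := by
  letI : CStarAlgebra (MatA N) := {}
  have hL2 : 2 ≤ F.L := (F.P 0).hL.2
  have hd : 2 ≤ (F.P K).d := by rw [T4Family.P_d]; norm_num
  set M₂ : ℕ := F.L * Mb + 44 + 2 * ρ with hM₂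
  have ha₀ := a0OfP_pos (F := F) (N := N) Mb ρ hB₁ hc₁
  have hεn : 0 < ε n := (hε n hnk).1
  have hMpos : 0 < Mb := hMb
  -- the cube letter `M₀ ∈ {Mb, L·Mb}` is positive and `M₀ + 44 + 2ρ ≤ M₂` (generation 0's bookkeeping, the letter `Mb` in place of the record's `M`)
  have hM₀pos : 1 ≤ M₀ := by
    rcases hM₀ with h | h
    · rw [h]; exact hMpos
    · rw [h]; exact Nat.one_le_iff_ne_zero.2 (Nat.mul_ne_zero (F.P 0).L_pos.ne' hMpos.ne')
  have hM₀' : M₀ + 44 + 2 * ρ ≤ M₂ := by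
    rcases hM₀ with h | h
    · rw [h, hM₂]; nlinarith [(F.P 0).L_pos]
    · rw [h, hM₂]
  have hεn1 : 0 < ε (n - 1) := (hε (n - 1) (by omega)).1
  have hεn1a : ε (n - 1) ≤ a0OfP F N Mb ρ B₁ c₁ := (hε (n - 1) (by omega)).2
  have hε2 : ε (n - 1) ≤ 2 * ε n := by
    have := hcomp (n - 1) (by omega)
    rwa [show n - 1 + 1 = n by omega] at this
  -- the print side `M′ = sideP ≤ M₀ + 44 + 2ρ ≤ M₂`
  have hside : sideP (F.P K) M₀ ρ ≤ M₂ := by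
    have := sideP_le (P := F.P K) M₀ ρ
    rw [T4Family.P_d] at this
    omega
  have hM'r : ((sideP (F.P K) M₀ ρ : ℕ) : ℝ) ≤ (M₂ : ℝ) := by exact_mod_cast hside
  have hM'pos : (0 : ℝ) < ((sideP (F.P K) M₀ ρ : ℕ) : ℝ) := by
    have := le_sideP (P := F.P K) M₀ (lt_of_lt_of_le (F.P K).L_pos hρ)
    exact_mod_cast (show 0 < sideP (F.P K) M₀ ρ by omega)
  have hM₂pos : (0 : ℝ) < M₂ := lt_of_lt_of_le hM'pos hM'r
  -- the collar clause, FROM THE `Within`-WITNESS (dag-n07-w4's `Sect2.hcollar_cubeIdxP'_of_within_mem`, by name) — the only place the record's sequence `s` enters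
  have hM₁ : 1 ≤ ν.M₁ := le_trans (Nat.one_le_iff_ne_zero.2 (Nat.mul_ne_zero (by omega) (by omega))) hfloor
  have hfloor' : (11 * (F.P K).d + 4 * ρ + M₀ + Dw) * (F.P K).L ≤ ν.M₁ := by rw [T4Family.P_d, T4Family.P_L]; exact hfloor
  have hcollar : cover (F.P K) '' (cubeIdxP' (F.P K) n hn1 M₀ ρ a).Ω 0 ⊆
      (if n - 1 = 0 then suppDomOfRecord F ν K s.Ω else s.Ω (n - 1)) := by
    rw [suppDomOfRecord_eq]
    exact Sect2.hcollar_cubeIdxP'_of_within_mem hM₁ s hsep hρ hM₀pos hfloor' hn1 hnk hx hy hxy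
  -- the smallness «7dL²M′α₀ ≤ c₁»
  have ha₀c : a0OfP F N Mb ρ B₁ c₁ ≤ c₁ / (56 * (F.L : ℝ) ^ 5 * M₂) := by rw [hM₂]; exact min_le_left _ _
  have ha₀w : a0OfP F N Mb ρ B₁ c₁ ≤ 1 / (8 * (M₂ : ℝ) * N * (28 * (F.L : ℝ) ^ 5 * B₁ * M₂) + 1) := by rw [hM₂]; exact min_le_right _ _
  have hc₁' : 7 * (F.P K).d * ((F.P K).L : ℝ) ^ 2 * (propCubeP (F.P K) n hn1 M₀ ρ hρ a).M * (((F.P K).L : ℝ) ^ 3 * ε (n - 1)) ≤ c₁ := by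
    rw [propCubeP_M, T4Family.P_d, T4Family.P_L]
    have h1 : 7 * (4 : ℕ) * (F.L : ℝ) ^ 2 * ((sideP (F.P K) M₀ ρ : ℕ) : ℝ) * ((F.L : ℝ) ^ 3 * ε (n - 1)) ≤ 28 * (F.L : ℝ) ^ 5 * M₂ * a0OfP F N Mb ρ B₁ c₁ := by
      have : 7 * (4 : ℕ) * (F.L : ℝ) ^ 2 * ((sideP (F.P K) M₀ ρ : ℕ) : ℝ) * ((F.L : ℝ) ^ 3 * ε (n - 1)) =
          28 * (F.L : ℝ) ^ 5 * ((sideP (F.P K) M₀ ρ : ℕ) : ℝ) * ε (n - 1) := by push_cast; ring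
      rw [this]; gcongr
    have h2 : 28 * (F.L : ℝ) ^ 5 * M₂ * a0OfP F N Mb ρ B₁ c₁ ≤ 28 * (F.L : ℝ) ^ 5 * M₂ * (c₁ / (56 * (F.L : ℝ) ^ 5 * M₂)) :=
      mul_le_mul_of_nonneg_left ha₀c (by positivity)
    have h3 : 28 * (F.L : ℝ) ^ 5 * M₂ * (c₁ / (56 * (F.L : ℝ) ^ 5 * M₂)) = c₁ / 2 := by field_simp; ring
    linarith
  -- the `2π`-window of the normalisation
  have h2π : (2 * boxWidth (bLo (F.P K).L (propCubeP (F.P K) n hn1 M₀ ρ hρ a).a n 0)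
      (bHi (F.P K).L (propCubeP (F.P K) n hn1 M₀ ρ hρ a).a (propCubeP (F.P K) n hn1 M₀ ρ hρ a).M n 0) + 1) *
      ((F.P K).eta n * N * (7 * (F.P K).d * ((F.P K).L : ℝ) ^ 2 * B₁ * (propCubeP (F.P K) n hn1 M₀ ρ hρ a).M * (((F.P K).L : ℝ) ^ 3 * ε (n - 1)) *
        (((F.P K).L : ℝ) ^ n * (F.P K).eta n)⁻¹)) < 2 * Real.pi := by
    have hbw := boxWidth_propCubeP (F.P K) n hn1 M₀ ρ hρ a
    rw [propCubeP_k] at hbw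
    rw [hbw, propCubeP_M, B12Eq115BackgroundPair.pow_mul_eta, inv_one, mul_one, T4Family.P_d, T4Family.P_L]
    have hη : (F.L : ℝ) ^ n * (F.P K).eta n = 1 := by have := B12Eq115BackgroundPair.pow_mul_eta (F.P K) n; rwa [T4Family.P_L] at this
    have hηpos : 0 < (F.P K).eta n := B3GkZeroTorusRescaled.eta_pos (F.P K) n
    have hW : (2 * ((4 : ℕ) * ((F.L : ℝ) ^ n * ((sideP (F.P K) M₀ ρ : ℕ) : ℝ) - 1)) + 1) * (F.P K).eta n ≤ 8 * ((sideP (F.P K) M₀ ρ : ℕ) : ℝ) := by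
      have : (2 * ((4 : ℕ) * ((F.L : ℝ) ^ n * ((sideP (F.P K) M₀ ρ : ℕ) : ℝ) - 1)) + 1) * (F.P K).eta n =
          8 * ((sideP (F.P K) M₀ ρ : ℕ) : ℝ) * ((F.L : ℝ) ^ n * (F.P K).eta n) - 7 * (F.P K).eta n := by push_cast; ring
      rw [this, hη, mul_one]; linarith
    have hr : 7 * (4 : ℕ) * (F.L : ℝ) ^ 2 * B₁ * ((sideP (F.P K) M₀ ρ : ℕ) : ℝ) * ((F.L : ℝ) ^ 3 * ε (n - 1)) ≤ 28 * (F.L : ℝ) ^ 5 * B₁ * M₂ * a0OfP F N Mb ρ B₁ c₁ := by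
      have : 7 * (4 : ℕ) * (F.L : ℝ) ^ 2 * B₁ * ((sideP (F.P K) M₀ ρ : ℕ) : ℝ) * ((F.L : ℝ) ^ 3 * ε (n - 1)) =
          28 * (F.L : ℝ) ^ 5 * B₁ * ((sideP (F.P K) M₀ ρ : ℕ) : ℝ) * ε (n - 1) := by push_cast; ring
      rw [this]; gcongr
    set X : ℝ := 8 * (M₂ : ℝ) * N * (28 * (F.L : ℝ) ^ 5 * B₁ * M₂) with hX
    have hX0 : 0 ≤ X := by positivity
    have hXa : X * a0OfP F N Mb ρ B₁ c₁ < 1 := by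
      calc X * a0OfP F N Mb ρ B₁ c₁ ≤ X * (1 / (X + 1)) := mul_le_mul_of_nonneg_left ha₀w hX0
        _ < 1 := by rw [mul_one_div, div_lt_one (by positivity)]; linarith
    have hNr : (0 : ℝ) ≤ N := Nat.cast_nonneg N
    calc (2 * ((4 : ℕ) * ((F.L : ℝ) ^ n * ((sideP (F.P K) M₀ ρ : ℕ) : ℝ) - 1)) + 1) *
          ((F.P K).eta n * N * (7 * (4 : ℕ) * (F.L : ℝ) ^ 2 * B₁ * ((sideP (F.P K) M₀ ρ : ℕ) : ℝ) * ((F.L : ℝ) ^ 3 * ε (n - 1))))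
        = ((2 * ((4 : ℕ) * ((F.L : ℝ) ^ n * ((sideP (F.P K) M₀ ρ : ℕ) : ℝ) - 1)) + 1) * (F.P K).eta n) *
          (N * (7 * (4 : ℕ) * (F.L : ℝ) ^ 2 * B₁ * ((sideP (F.P K) M₀ ρ : ℕ) : ℝ) * ((F.L : ℝ) ^ 3 * ε (n - 1)))) := by ring
      _ ≤ (8 * ((sideP (F.P K) M₀ ρ : ℕ) : ℝ)) * (N * (28 * (F.L : ℝ) ^ 5 * B₁ * M₂ * a0OfP F N Mb ρ B₁ c₁)) := by
          gcongr
      _ ≤ (8 * (M₂ : ℝ)) * (N * (28 * (F.L : ℝ) ^ 5 * B₁ * M₂ * a0OfP F N Mb ρ B₁ c₁)) := by gcongr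
      _ = X * a0OfP F N Mb ρ B₁ c₁ := by rw [hX]; ring
      _ < 1 := hXa
      _ < 2 * Real.pi := by linarith [Real.pi_gt_three]
  -- the non-wrapping hypothesis in the datum's own letters (the projections of `propCubeP` are `rfl`)
  have hinj' : Set.InjOn (cover (F.P K))
      (cube (F.P K).L (propCubeP (F.P K) n hn1 M₀ ρ hρ a).a (propCubeP (F.P K) n hn1 M₀ ρ hρ a).M (propCubeP (F.P K) n hn1 M₀ ρ hρ a).ρ n 0) := hinj
  obtain ⟨u, A, h1, h2, h3, h4, h4', h5⟩ :=
    exists_localGauge152_REfiner153_coverBox_propCubeP_of_prop6P (P := F.P K) hd hB₁ (dvd_refl ρ) hρ hP6 U h17 h19 hn1 (by omega) hnK hεn1 a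
      hinj' hcollar hc₁' h2π
  -- the letters at `b9OfP F Mb ρ B₁ · ε_n`
  have hbound : 2 * (7 * (F.P K).d * ((F.P K).L : ℝ) ^ 2 * B₁ * (propCubeP (F.P K) n hn1 M₀ ρ hρ a).M * (((F.P K).L : ℝ) ^ 3 * ε (n - 1))) <
      b9OfP F Mb ρ B₁ * ε n := by
    rw [propCubeP_M, T4Family.P_d, T4Family.P_L, b9OfP]
    have : 2 * (7 * (4 : ℕ) * (F.L : ℝ) ^ 2 * B₁ * ((sideP (F.P K) M₀ ρ : ℕ) : ℝ) * ((F.L : ℝ) ^ 3 * ε (n - 1))) =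
        56 * (F.L : ℝ) ^ 5 * B₁ * ((sideP (F.P K) M₀ ρ : ℕ) : ℝ) * ε (n - 1) := by push_cast; ring
    rw [this]
    calc 56 * (F.L : ℝ) ^ 5 * B₁ * ((sideP (F.P K) M₀ ρ : ℕ) : ℝ) * ε (n - 1) ≤ 56 * (F.L : ℝ) ^ 5 * B₁ * M₂ * (2 * ε n) := by gcongr
      _ = (112 * (F.L : ℝ) ^ 5 * B₁ * M₂) * ε n := by ring
      _ < (112 * (F.L : ℝ) ^ 5 * B₁ * ((F.L * Mb + 44 + 2 * ρ : ℕ) : ℝ) + 1) * ε n := by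
          rw [hM₂]; exact mul_lt_mul_of_pos_right (lt_add_one _) hεn
  exact ⟨u, A, h1, fun b hb => (h2 b hb).trans_lt hbound, fun q hq => (h3 q hq).trans_lt hbound, fun b hb => (h4 b hb).trans_lt hbound,
    fun b hb => (h4' b hb).trans_lt hbound, h5⟩

/-- ★ **THE SAME AT STUB 2′'s BARE `ρ₀ ≥ 1`, UNIFORM IN THE RECORD'S BASIC CUBE SIZE** (`ρ := ρ₀·L ≥ L`, by `prop6Printed_zdCubP_anti`; floor
`(11·4 + 4·(ρ₀L) + M₀ + Dw)·L`, constants `b9OfP F Mb (ρ₀L) B₁`, `a0OfP F N Mb (ρ₀L) B₁ c₁` keyed on the cube letter `Mb`, the record's `M` free) — the `Within`-witness door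
in the letters of V19's stub 2′ `stub_prop6MemberB8AtP13` (SOME `ρ₀ ≥ 1`), callable from inside the S6 head's `Mc`-keyed R-tokens under `∀ M`.
[cite: Balaban1985Variational, (144) p.300, (150)–(153) p.301; Balaban1985RegularSpaces, Prop. 6 p.99, p.98 («M is a multiple of R₁M₁»); Balaban1984PropagatorsII, (2.12) p.225] -/
theorem gauge152_REfiner153_box_of_within_of_prop6P_uniform_of_one_le {B₁ c₁ : ℝ} (hB₁ : 0 ≤ B₁) (hc₁ : 0 < c₁) {ρ₀ : ℕ} (hρ₀ : 1 ≤ ρ₀)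
    (hP6 : letI : CStarAlgebra (MatA N) := {}; B8.Prop6Printed 4 (F.L : ℝ) B₁ c₁ (fun i : ZdIdx 4 F.L => zdCubP (MatA N) F.L ρ₀ i)) {Mb : ℕ} (hMb : 1 ≤ Mb)
    (ν : Stage7Numerics) {M : ℕ} (g : ℕ → ℝ) (K k : ℕ) (s : SeqOfRecord F ν M g K k) (hsep : Sect2.SeqSeparated ν.M₁ s)
    (ε : ℕ → ℝ)
    (hε : ∀ m, m ≤ k → 0 < ε m ∧ ε m ≤ a0OfP F N Mb (ρ₀ * F.L) B₁ c₁) (hcomp : ∀ m, m < k → ε m ≤ 2 * ε (m + 1))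
    (U : GaugeField (F.P K) 0 (SU N))
    (h17 : ∀ m, m ≤ k → PlaqSmallOn (Sect2.omegaPlaqsTop s.Ω (suppDomOfRecord F ν K s.Ω) m) (ε m * (F.P K).eta m ^ 2) U)
    (h19 : ∀ m, m ≤ k → Sect2.CoDivSmallOn (Sect2.omegaBondsTop s.Ω (suppDomOfRecord F ν K s.Ω) m) (ε m * (F.P K).eta m ^ 3) U)
    {n : ℕ} (hn1 : 1 ≤ n) (hnk : n ≤ k) (hnK : n ≤ (F.P K).m + (F.P K).K) {M₀ : ℕ} (hM₀ : M₀ = Mb ∨ M₀ = F.L * Mb)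
    {Dw : ℕ} (hfloor : (11 * 4 + 4 * (ρ₀ * F.L) + M₀ + Dw) * F.L ≤ ν.M₁) (a : Pt (F.P K).d) {x y : Pt (F.P K).d}
    (hx : x ∈ cubeExt (side (F.P K).L M₀ n) a 0) (hy : cover (F.P K) y ∈ s.Ω n) (hxy : Within (Dw : ℤ) x y)
    (hinj : Set.InjOn (cover (F.P K)) (cube (F.P K).L (cornerP (F.P K) M₀ (ρ₀ * F.L) a) (sideP (F.P K) M₀ (ρ₀ * F.L)) (ρ₀ * F.L) n 0)) :
    ∃ u : GaugeTransf (F.P K) 0 (SU N), ∃ A : PBond (F.P K) 0 → MatA N,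
      (∀ b ∈ (Sect2.regionOfSet (F.P K) (cover (F.P K) '' box (F.P K).L (cornerP (F.P K) M₀ (ρ₀ * F.L) a) (sideP (F.P K) M₀ (ρ₀ * F.L)) n)).bonds,
          gaugeU (fun x => ιSU N (u x)) (fun b' => ιSU N (U b')) b = expI ((F.P K).eta n) (A b)) ∧
      (∀ b ∈ (Sect2.regionOfSet (F.P K) (cover (F.P K) '' box (F.P K).L (cornerP (F.P K) M₀ (ρ₀ * F.L) a) (sideP (F.P K) M₀ (ρ₀ * F.L)) n)).bonds,
          ‖A b‖ < b9OfP F Mb (ρ₀ * F.L) B₁ * ε n) ∧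
      (∀ q ∈ (Sect2.regionOfSet (F.P K) (cover (F.P K) '' box (F.P K).L (cornerP (F.P K) M₀ (ρ₀ * F.L) a) (sideP (F.P K) M₀ (ρ₀ * F.L)) n)).dpairs,
          ‖grad ((F.P K).eta n) q.2.1 (fun y => A ⟨y, q.2.2⟩) q.1‖ < b9OfP F Mb (ρ₀ * F.L) B₁ * ε n) ∧
      (∀ b ∈ Sect2.bondsDeep (cover (F.P K) '' box (F.P K).L (cornerP (F.P K) M₀ (ρ₀ * F.L) a) (sideP (F.P K) M₀ (ρ₀ * F.L)) n),
          ‖Sect2.codiffCurlA ((F.P K).eta n) A b.src b.dir‖ < b9OfP F Mb (ρ₀ * F.L) B₁ * ε n) ∧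
      (∀ b ∈ Sect2.bondsDeep (cover (F.P K) '' box (F.P K).L (cornerP (F.P K) M₀ (ρ₀ * F.L) a) (sideP (F.P K) M₀ (ρ₀ * F.L)) n),
          ‖∑ ν' : Fin (F.P K).d, (((F.P K).eta n : ℝ) : ℂ)⁻¹ •
              (grad ((F.P K).eta n) ν' (fun y => A ⟨y, b.dir⟩) (b.src.unshift ν') - grad ((F.P K).eta n) ν' (fun y => A ⟨y, b.dir⟩) b.src)‖ <
            b9OfP F Mb (ρ₀ * F.L) B₁ * ε n) ∧
      (∀ D' : Domains (F.P K),
        LinearMap.ker (QpE D') ≤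
            LinearMap.ker (QpE (cubeDomains (F.P K) (cornerP (F.P K) M₀ (ρ₀ * F.L) a) (sideP (F.P K) M₀ (ρ₀ * F.L)) (ρ₀ * F.L) n hnK)) →
        ∀ φ : MatA N →L[ℂ] ℂ,
          RE D' ((F.P K).eta n)⁻¹ (dsE ((F.P K).eta n)⁻¹ (WithLp.toLp 2 fun b => (φ (A b)).re : BondSpace (F.P K))) = 0 ∧
          RE D' ((F.P K).eta n)⁻¹ (dsE ((F.P K).eta n)⁻¹ (WithLp.toLp 2 fun b => (φ (A b)).im : BondSpace (F.P K))) = 0) := by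
  letI : CStarAlgebra (MatA N) := {}
  exact gauge152_REfiner153_box_of_within_of_prop6P_uniform hB₁ hc₁ (prop6Printed_zdCubP_anti (fun i : ZdIdx 4 F.L => i) (Dvd.intro F.L rfl) hP6) hMb ν g K k
    (Nat.le_mul_of_pos_left F.L hρ₀) s hsep ε hε hcomp U h17 h19 hn1 hnk hnK hM₀ hfloor a hx hy hxy hinj

end Uniform

end Literature.MathematicalPhysics.QuantumFieldTheory.Balaban1983to89.Node00

end
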